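import Literature.AnabelianGeometry.EtaleTheta.Discharge.Sec3Def36NonzeroConstants
import Literature.AnabelianGeometry.EtaleTheta.Discharge.Sec3Prop34CnstOfRlfZ
import HarnessLib

/-!
# [EtTh] Def. 3.6 (i)/(ii)(b): the constant line `ℝ·Φ₀^cnst` and the integrality of `Φ₀^ℝ` AT THE CONSTRUCTED
# Def. 3.6 (i) data `RealifiedDivisorMonoids.ofRlfZ` (monoid type `ℤ`) — `hInt` DISCHARGED, `hLine` from one
# property of the Def. 3.3 (iii) data

S. Mochizuki, *The étale theta function …*, Publ. RIMS **45** (2009) [EtTh], §3: Def. 3.3 (iii) PDF p.73,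
Prop. 3.4 (ii) p.74, Def. 3.6 (i)–(ii) pp.76–77 of `paper:doi-10-2977-prims-1234361159`
[cite: MochizukiEtTh2009, Def 3.6 p.76] [cite: MochizukiEtTh2009, Prop 3.4 (ii) p.74]:

> (Prop. 3.4 (ii)) "… natural isomorphisms of monoids `O_L^× ⥲ Ker(B₀(Y^log) → Φ₀^gp(Y^log))`;
> `O_L^▷ ⥲ B₀(Y^log) ×_{Φ₀^gp(Y^log)} Φ₀(Y^log)`; `L^× ⥲ F₀(Y^log)`"
> (Def. 3.6 (i)) "`Φ₀^ℝ := Φ₀^rlf` … `ℝ·Φ₀^cnst ⊆ (Φ₀^ℝ)^gp` … the `ℝ`-vector subspace generated by `Φ₀^cnst`"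

abc-iut cell, layer L2, seat abc-iut-w4-d008 (gen 3); proof-only sequel (0 defs) of
`Discharge/Sec3Def36NonzeroConstants.lean` (same seat, p425592).  There the bracketed sentence of Def. 3.6 (ii)(b)
(`hNZ`, binder of row C38-L05) — and, in abc-iut-w5-d250's `Discharge/Sec3Thm37RatStdOfLine.lean`, print's input
"`Π^tp_X` acts trivially on `K^×/O_K^×`" of Thm. 3.7 (ii) — were reduced to two properties of the Def. 3.6 (i)
DATA that the abstract interface `RealifiedDivisorMonoids` leaves free (kernel: `TemperedFrobenioidToyHNZ.lean`):

* `hLine` — every element of `ℝ·Φ₀^cnst(Y)` is effective or anti-effective in `(Φ₀^ℝ)^gp(Y)`;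
* `hInt`  — `Φ₀^ℝ(Y)` is integral.

THIS FILE evaluates both at THE Def. 3.6 (i) data of monoid type `ℤ` CONSTRUCTED from the Def. 3.3 (iii) data
`dm` (`RealifiedDivisorMonoids.ofRlfZ dm hpf`, abc-iut-L6-t12: `Φ₀^ℝ := Φ₀^rlf` by [FrdI] Def. 2.4 (i),
`ℝ·Φ₀^cnst :=` the GENUINE `ℝ`-span of `Φ₀^cnst` in the `ℝ`-vector space `(Φ₀^rlf)^gp`, `B₀^ℤ = B₀`, `F₀^ℤ = F₀`):

* `RealifiedDivisorMonoids.ofRlfZ_isCancelMul` — **`hInt` holds with NO hypothesis**: `Φ₀(Y)^rlf ⊆ ∏_𝔭 ℝ_{≥0}`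
  is cancellative (abc-iut-L1 `IsPerfFactorial.Rlf.isCancelMul`);
* `RealifiedDivisorMonoids.ofRlfZ_line` — **`hLine` holds given ONE property of the Def. 3.3 (iii) data**, the
  binder `hcyc : ∀ Y, ∃ d ∈ Φ₀(Y), ∀ b ∈ F₀(Y), ∃ n : ℤ, div₀(b) = dⁿ` ("the log-divisor of a constant
  `c ∈ L^× = F₀(Y)` is `v_L(c)`·`div(ϖ_L)`", `d = div(ϖ_L)` the — effective — divisor of a uniformiser: the
  content of Prop. 3.4 (ii)'s isomorphisms for the DIVISORS of constants; a statement about `(Φ₀, B₀, div₀, F₀)`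
  alone, of the genre of `DivisorMonoids.CnstNonCuspidal`, carried inline — no definition is added): then
  `Φ₀^cnst(Y) ⊆ d^ℤ`, so `ℝ·Φ₀^cnst(Y) = ℝ·ι(d) = {ι(d)^r}` (`rsmul_add`), and `r • ι(d) = [d^{r}]` is effective for
  `r ≥ 0`, the inverse of the effective `[d^{−r}]` for `r ≤ 0` (`IsPerfFactorial.Rlf.realSMul_of`, real powers in
  the realification);
* `RealifiedDivisorMonoids.ofRlfZ_mem_FΛ_of_divΛ_eq_of` — the third binder `hP34Λ` at `ofRlfZ` from the typed
  `B₀`-level Prop. 3.4 (ii) `dm.Prop34` alone (the first clause of abc-iut-w4-d084's / L6-t12's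
  `Prop34Cnst.ofRlfZ`, p418261, which also asks `Prop34Cnst₀`; via `RlfEffective.exists_eq_of`);
* **`TemperedFrobenioid.exists_cnstFn_effective_ofRlfZ`** — hence `hNZ` (Def. 3.6 (ii)(b), bracketed sentence,
  VERBATIM) for EVERY tempered Frobenioid over `ofRlfZ dm hpf`, modulo `dm.Prop34` + `hcyc` only, and
  `TemperedFrobenioid.bsFldPreStepLimitCriterion_ofRlfZ` — row C38-L05 there modulo `dm.Prop34`, `hcyc`, `hSup`.

So at the data the §4–§5 theory actually uses ("a tempered Frobenioid whose monoid type is `ℤ`", §4 p.86) the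
residual of GAP rows G-w5d124-2 / G-w5d250-1 is ONE printed property of the Def. 3.3 (iii) data (`hcyc`).
HONEST FRAMING: refereed pre-IUT material ([EtTh] §3 over [FrdI] §2); nothing here bears on [IUTchIII]
Cor. 3.12; no statement of the paper is strengthened; typed ≠ proved for the rest of §3.
-/

noncomputable section

namespace Literature.AnabelianGeometry.EtaleTheta

open CategoryTheory Opposite Literature.AlgebraicGeometry.Frobenioids

universe u₀ v₀ u v w

namespace RealifiedDivisorMonoids

variable {D₀ : Type u} [Category.{v} D₀] (dm : DivisorMonoids.{u, v, w} D₀)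
  (hpf : ∀ Y : D₀ᵒᵖ, IsPerfFactorial (dm.Φ₀.obj Y))

/-! ### `hInt` at `ofRlfZ`: no hypothesis -/

/-- **`Φ₀^ℝ(Y) = Φ₀(Y)^rlf` is integral** for the constructed Def. 3.6 (i) data `ofRlfZ dm hpf`: the
realification of a perf-factorial monoid is a submonoid of `∏_𝔭 ℝ_{≥0}` ([FrdI] Def. 2.4 (i)(c)), hence
cancellative — the binder `hInt` of `TemperedFrobenioid.exists_cnstFn_effective_of_line` DISCHARGED at this data.
[cite: MochizukiFrdI2008, Def. 2.4 (i) p.48] -/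
theorem ofRlfZ_isCancelMul (Y : D₀ᵒᵖ) : IsCancelMul ((ofRlfZ dm hpf).ΦR.obj Y) :=
  IsPerfFactorial.Rlf.isCancelMul (hpf Y)

/-! ### `hP34Λ` at `ofRlfZ` from the `B₀`-level Prop. 3.4 (ii) -/

/-- **Prop. 3.4 (ii), second isomorphism, at the constructed data** (`B₀^ℤ = B₀`, `F₀^ℤ = F₀`): an element of
`B₀(Y)` whose log-divisor becomes effective in `(Φ₀^rlf)^gp(Y)` is already effective in `Φ₀^gp(Y)`
(`RlfEffective.exists_eq_of`), hence constant by the typed `dm.Prop34` — the binder `hP34Λ` at `ofRlfZ dm hpf`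
from `Prop34` ALONE (cf. `Prop34Cnst.ofRlfZ`, which packages this with the naturality clauses `Prop34Cnst₀`).
[cite: MochizukiEtTh2009, Prop 3.4 (ii) p.74] -/
theorem ofRlfZ_mem_FΛ_of_divΛ_eq_of {V : FrdIMonoidStub.{w}} {V₀ : FrdICatStub.{u, v, w} D₀}
    (h34 : dm.Prop34 V V₀) (Y : D₀ᵒᵖ) (b : (ofRlfZ dm hpf).BΛ.obj Y) (x : (ofRlfZ dm hpf).ΦR.obj Y)
    (hbx : (ofRlfZ dm hpf).divΛ Y b = Algebra.GrothendieckGroup.of x) : b ∈ (ofRlfZ dm hpf).FΛ Y := by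
  obtain ⟨x₀, hx₀, -⟩ := RlfEffective.exists_eq_of (hpf Y) (dm.div₀ Y b) x hbx
  exact h34.mem_F₀_of_div₀_mem Y b x₀ hx₀

/-! ### `hLine` at `ofRlfZ`: the `ℝ`-span of a cyclic group of constants' divisors is a line of
(anti-)effective elements -/

/-- `0 • x = 1` for any realification data (from `(0 + 0) • x = (0 • x)(0 • x)`).
[cite: MochizukiFrdI2008, Def. 2.4 (i) p.48] -/
theorem rsmul_zero_eq_one {Φ : D₀ᵒᵖ ⥤ CommMonCat.{w}} (R : RealificationData Φ) (X : D₀)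
    (x : Algebra.GrothendieckGroup (R.rlf.obj (op X))) : R.rsmul X 0 x = 1 := by
  have h := R.rsmul_add X 0 0 x
  rw [add_zero] at h
  exact (mul_left_cancel (h.symm.trans (mul_one _).symm))

/-- **Real multiples of the class of an element of `Φ₀(Y)` are (anti-)effective** in `(Φ₀(Y)^rlf)^gp`, for THE
realification data: `r • ι^gp[d] = [ι(d)^{r}]` if `r ≥ 0`, `= [ι(d)^{−r}]⁻¹` if `r ≤ 0` (the `ℝ`-vector-space
structure of `(Φ₀^rlf)^gp` by real powers, [FrdI] Def. 2.4 (i); `IsPerfFactorial.Rlf.realSMul_of`).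
[cite: MochizukiFrdI2008, Def. 2.4 (i) p.48] -/
theorem canonical_rsmul_toRlfGp_of_eq_or {Φ : D₀ᵒᵖ ⥤ CommMonCat.{w}} (hΦ : ∀ Y : D₀ᵒᵖ, IsPerfFactorial (Φ.obj Y))
    (X : D₀) (r : ℝ) (d : Φ.obj (op X)) :
    ∃ c : (hΦ (op X)).Rlf,
      (RealificationData.canonical Φ hΦ).rsmul X r
          ((RealificationData.canonical Φ hΦ).toRlfGp X (Algebra.GrothendieckGroup.of d)) =
        Algebra.GrothendieckGroup.of c ∨
      (RealificationData.canonical Φ hΦ).rsmul X r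
          ((RealificationData.canonical Φ hΦ).toRlfGp X (Algebra.GrothendieckGroup.of d)) =
        (Algebra.GrothendieckGroup.of c)⁻¹ := by
  have key : (RealificationData.canonical Φ hΦ).rsmul X r
      ((RealificationData.canonical Φ hΦ).toRlfGp X (Algebra.GrothendieckGroup.of d)) =
      Algebra.GrothendieckGroup.of (IsPerfFactorial.Rlf.rpow (hΦ (op X)) r.toNNReal
          (((RealificationData.canonical Φ hΦ).toRlf.app (op X)).hom d)) /
        Algebra.GrothendieckGroup.of (IsPerfFactorial.Rlf.rpow (hΦ (op X)) (-r).toNNReal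
          (((RealificationData.canonical Φ hΦ).toRlf.app (op X)).hom d)) := by
    rw [RealificationData.toRlfGp, MonGp.map_of]
    exact IsPerfFactorial.Rlf.realSMul_of (hΦ (op X)) r _
  rcases le_total 0 r with hr | hr
  · refine ⟨IsPerfFactorial.Rlf.rpow (hΦ (op X)) r.toNNReal
      (((RealificationData.canonical Φ hΦ).toRlf.app (op X)).hom d), Or.inl ?_⟩
    rw [Real.toNNReal_of_nonpos (neg_nonpos.mpr hr), IsPerfFactorial.Rlf.rpow_zero, map_one, div_one] at key
    exact key
  · refine ⟨IsPerfFactorial.Rlf.rpow (hΦ (op X)) (-r).toNNReal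
      (((RealificationData.canonical Φ hΦ).toRlf.app (op X)).hom d), Or.inr ?_⟩
    rw [Real.toNNReal_of_nonpos hr, IsPerfFactorial.Rlf.rpow_zero, map_one, one_div] at key
    exact key

/-- **The constant line of `ofRlfZ` is contained in the real line through `ι(d)`** when the divisors of the
constants `F₀(Y)` are the integer powers of one `d ∈ Φ₀(Y)` (`hd`): `ℝ·Φ₀^cnst(Y) ⊆ {r • ι^gp[d] : r ∈ ℝ}` — the
generators `r • ι^gp(c)`, `c ∈ ⟨Φ₀^cnst(Y)⟩ ⊆ d^ℤ`, are `(k r) • ι^gp[d]`, and these form a subgroup (`rsmul_add`).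
[cite: MochizukiEtTh2009, Def 3.6 p.76] -/
theorem ofRlfZ_cnstR_subset_line (X : D₀) (d : dm.Φ₀.obj (op X))
    (hd : ∀ b ∈ dm.F₀ (op X), ∃ n : ℤ, dm.div₀ (op X) b = Algebra.GrothendieckGroup.of d ^ n)
    {g : Algebra.GrothendieckGroup ((ofRlfZ dm hpf).ΦR.obj (op X))} (hg : g ∈ (ofRlfZ dm hpf).cnstR (op X)) :
    ∃ r : ℝ, g = (realData dm hpf).rsmul X r ((realData dm hpf).toRlfGp X (Algebra.GrothendieckGroup.of d)) := by
  -- the line through `δ = ι^gp[d]`, as the range of the homomorphism `r ↦ r • δ`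
  let ψ : Multiplicative ℝ →* Algebra.GrothendieckGroup ((realData dm hpf).rlf.obj (op X)) :=
    { toFun := fun t => (realData dm hpf).rsmul X (Multiplicative.toAdd t)
        ((realData dm hpf).toRlfGp X (Algebra.GrothendieckGroup.of d))
      map_one' := by
        change (realData dm hpf).rsmul X (Multiplicative.toAdd 1) _ = 1
        rw [toAdd_one]
        exact rsmul_zero_eq_one (realData dm hpf) X _
      map_mul' := fun s t => by
        change (realData dm hpf).rsmul X (Multiplicative.toAdd (s * t)) _ =
          (realData dm hpf).rsmul X (Multiplicative.toAdd s) _ * (realData dm hpf).rsmul X (Multiplicative.toAdd t) _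
        rw [toAdd_mul, (realData dm hpf).rsmul_add] }
  have hψ : ∀ t, ψ t = (realData dm hpf).rsmul X (Multiplicative.toAdd t)
      ((realData dm hpf).toRlfGp X (Algebra.GrothendieckGroup.of d)) := fun _ => rfl
  -- (1) `⟨Φ₀^cnst(Y)⟩ ⊆ d^ℤ`
  have h1 : dm.cnstGp.carrier X ≤ Subgroup.zpowers (Algebra.GrothendieckGroup.of d) := by
    change Subgroup.closure _ ≤ _
    rw [Subgroup.closure_le]
    intro c hc
    have hc' : c ∈ (dm.F₀ (op X)).map (dm.div₀ (op X)) := hc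
    obtain ⟨b, hb, rfl⟩ := Submonoid.mem_map.1 hc'
    obtain ⟨n, hn⟩ := hd b hb
    exact Subgroup.mem_zpowers_iff.2 ⟨n, hn.symm⟩
  -- (2) `ℝ·Φ₀^cnst(Y) ⊆ range ψ`
  have h2 : ((realData dm hpf).realSpan dm.cnstGp).carrier X ≤ ψ.range := by
    change Subgroup.closure _ ≤ _
    rw [Subgroup.closure_le]
    rintro _ ⟨r, c, hc, rfl⟩
    obtain ⟨k, rfl⟩ := Subgroup.mem_zpowers_iff.1 (h1 hc)
    refine MonoidHom.mem_range.2 ⟨Multiplicative.ofAdd r ^ k, ?_⟩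
    rw [map_zpow, hψ, toAdd_ofAdd, map_zpow, map_zpow]
  -- (3) read off `g = r • δ`
  obtain ⟨t, ht⟩ := MonoidHom.mem_range.1 (h2 hg)
  exact ⟨Multiplicative.toAdd t, by rw [← ht, hψ]⟩

/-- **`hLine` at the constructed Def. 3.6 (i) data `ofRlfZ dm hpf`** (monoid type `ℤ`): if for every `Y` the
log-divisors of the constants `F₀(Y)` are the integer powers of one element `d ∈ Φ₀(Y)` (`hcyc` — print:
`div₀(c) = v_L(c)·div(ϖ_L)` for `c ∈ L^× ≅ F₀(Y)`, Prop. 3.4 (ii)), then EVERY element of the genuine `ℝ`-span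
`ℝ·Φ₀^cnst(Y) ⊆ (Φ₀^rlf)^gp(Y)` is effective or anti-effective — exactly the binder `hLine` of
`TemperedFrobenioid.exists_cnstFn_effective_of_line` / `Sec3Thm37RatStdOfLine`, VERBATIM, at `T := ofRlfZ dm hpf`.
[cite: MochizukiEtTh2009, Def 3.6 p.76] -/
theorem ofRlfZ_line
    (hcyc : ∀ Y : D₀ᵒᵖ, ∃ d : dm.Φ₀.obj Y, ∀ b ∈ dm.F₀ Y, ∃ n : ℤ,
      dm.div₀ Y b = Algebra.GrothendieckGroup.of d ^ n) :
    ∀ (Y : D₀ᵒᵖ) (g : Algebra.GrothendieckGroup ((ofRlfZ dm hpf).ΦR.obj Y)), g ∈ (ofRlfZ dm hpf).cnstR Y →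
      ∃ r : (ofRlfZ dm hpf).ΦR.obj Y,
        g = Algebra.GrothendieckGroup.of r ∨ g = (Algebra.GrothendieckGroup.of r)⁻¹ := by
  rintro ⟨X⟩ g hg
  obtain ⟨d, hd⟩ := hcyc (op X)
  obtain ⟨r, rfl⟩ := ofRlfZ_cnstR_subset_line dm hpf X d hd hg
  exact canonical_rsmul_toRlfGp_of_eq_or hpf X r d

end RealifiedDivisorMonoids

/-! ### Def. 3.6 (ii)(b), bracketed sentence, and row C38-L05 for tempered Frobenioids over `ofRlfZ` -/

namespace TemperedFrobenioid

variable {D₀ : Type u} [Category.{v} D₀] {dm : DivisorMonoids.{u, v, w} D₀}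
  {hpf : ∀ Y : D₀ᵒᵖ, IsPerfFactorial (dm.Φ₀.obj Y)} {V : FrdIMonoidStub.{w}} {V₀ : FrdICatStub.{u, v, w} D₀}
  {D : Type u₀} [Category.{v₀} D] {VD : FrdICatStub.{u₀, v₀, w} D}
  (C₀ : TemperedFrobenioid (RealifiedDivisorMonoids.ofRlfZ dm hpf) D VD)

/-- **Def. 3.6 (ii)(b), bracketed sentence ("the image of `F(A) → (Φ^{bs-fld})^gp(A)` contains a nonzero
element of `Φ^{bs-fld}(A)`"), for EVERY tempered Frobenioid over the constructed Def. 3.6 (i) data of monoid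
type `ℤ`** — the binder `hNZ` of row C38-L05 VERBATIM — modulo two statements about the Def. 3.3 (iii) data
only: the typed Prop. 3.4 (ii) `dm.Prop34` and `hcyc` (divisors of constants are powers of one log-divisor).
[cite: MochizukiEtTh2009, Def 3.6 p.77] -/
theorem exists_cnstFn_effective_ofRlfZ (h34 : dm.Prop34 V V₀)
    (hcyc : ∀ Y : D₀ᵒᵖ, ∃ d : dm.Φ₀.obj Y, ∀ b ∈ dm.F₀ Y, ∃ n : ℤ,
      dm.div₀ Y b = Algebra.GrothendieckGroup.of d ^ n)
    (A : Dᵒᵖ) :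
    ∃ u : ((RealifiedDivisorMonoids.ofRlfZ dm hpf).BΛ.obj (C₀.baseOp A) : Type w) ×
        Algebra.GrothendieckGroup (C₀.Φ.carrier A),
      u ∈ C₀.cnstFn A ∧ ∃ Z : C₀.Φ.carrier A, Z ≠ 1 ∧ u.2 = Algebra.GrothendieckGroup.of Z :=
  C₀.exists_cnstFn_effective_of_line (RealifiedDivisorMonoids.ofRlfZ_line dm hpf hcyc)
    (RealifiedDivisorMonoids.ofRlfZ_isCancelMul dm hpf)
    (RealifiedDivisorMonoids.ofRlfZ_mem_FΛ_of_divΛ_eq_of dm hpf h34) A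

/-- **Row C38-L05 of the [EtTh] Cor. 3.8 sub-DAG for tempered Frobenioids over `ofRlfZ dm hpf`** (monoid type
`ℤ`): abc-iut-w5-d124's `bsFldPreStepLimitCriterion_of` with `hP34Λ`, `hNZ` supplied — modulo `dm.Prop34`,
`hcyc`, and the supremum property `hSup` (G-w5d124-3, abc-iut-w4-d084's row).
[cite: MochizukiEtTh2009, Cor 3.8 p.81] -/
theorem bsFldPreStepLimitCriterion_ofRlfZ (hF : PreFrobenioid.IsFrobenioid C₀.toElem) (h34 : dm.Prop34 V V₀)
    (hcyc : ∀ Y : D₀ᵒᵖ, ∃ d : dm.Φ₀.obj Y, ∀ b ∈ dm.F₀ Y, ∃ n : ℤ,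
      dm.div₀ Y b = Algebra.GrothendieckGroup.of d ^ n)
    (hSup : ∀ (W : D) (m : Perfection (C₀.divisorMonoid.obj (op W)))
      (U : Set (Perfection (C₀.divisorMonoid.obj (op W)))),
      U ⊆ C₀.bsFldPf W → U.Nonempty → (∀ u ∈ U, u ∣ m) → ∃ y ∈ C₀.bsFldPf W, (∀ u ∈ U, u ∣ y) ∧ y ∣ m) :
    C₀.BsFldPreStepLimitCriterion (PreFrobenioidData.perfection hF) :=
  C₀.bsFldPreStepLimitCriterion_of_line hF (RealifiedDivisorMonoids.ofRlfZ_mem_FΛ_of_divΛ_eq_of dm hpf h34)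
    (RealifiedDivisorMonoids.ofRlfZ_line dm hpf hcyc) (RealifiedDivisorMonoids.ofRlfZ_isCancelMul dm hpf) hSup

end TemperedFrobenioid

end Literature.AnabelianGeometry.EtaleTheta

end
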